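/-
Copyright (c) 2026 the pub-hodgecm-mathlib formalisation cell (harness21).  Prover seat hodgecm-mathlib-R90-CS-p03 (g3), R90-TF section S8 «ContSpec-n½» (dealer R90-CS-plan (g3),
S8-R216∕R218 «`K2E1ChiArchBigCellLastRowReadingsU3` — pay the arch last-row letters `hℓ ∕ hy ∕ h0 ∕ h2`»): the four LAST-ROW READINGS of ★ p13's big-cell laws
(`archSectionE_midBlock_bigCell`, `archSectionShifted_midBlock_bigCell`) AT THE ARCHIMEDEAN BIG-CELL ELEMENT OF RECORD `a := (ι(w₀)·u(X, θ t))_∞` — its last row is `(1, X, Z)` with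
`Z_w = s_w(t)·φ_w(δ) − ½‖X_w‖²`, its `ℓ`-functional is the archimedean idele `(Z − 1, 1)` — so that those laws hold at `a` with NO visible letter.
-/
import Summits.HodgeConjecture.HodgeConjecture.Theorems.R90S8ChiSectionPairArchSectionShiftedU3      -- ★ p864245 (K2E1-p13 (g5)): `archSectionShifted_midBlock_bigCell`; brings ★ `archSectionE_midBlock_bigCell`, `archLastRow`, `archLastRowL`, `archPart`
import Summits.HodgeConjecture.HodgeConjecture.Theorems.R90S8ChiSectionPairArchSectionContinuityU3   -- ★ 3b (K2E1-p11): `archLastRow_snd`, `archLastRowL_snd` (finite parts of the last row of `ι_∞ a`)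
import Summits.HodgeConjecture.HodgeConjecture.Theorems.K2E1HeightBigCellLineFormulaU3             -- ★ (a2)₃: `lastRow_weylLongU_mul_heisChart`, `extensionEmbedding_fst_heisZ`, `extensionEmbedding_fst_coe_traceZeroLine`, `embedding_re_eq_zero`
import Literature.NumberTheory.Automorphic.RelNormOneTorusArch                                      -- ★ `coe_infiniteIdeles_eq` (`(y, 1)`)
import HarnessLib

/-!
# K2·E1 ∕ R90·S8 — `K2E1ChiArchBigCellLastRowReadingsU3`: THE LAST ROW `(1, X, Z)` OF THE ARCHIMEDEAN BIG-CELL ELEMENT `(ι(w₀)·u(X, θ t))_∞` — THE LETTERS `hℓ hy h0 h2` OF ★ p13's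
# BIG-CELL LAWS, PAID

Cell `pub/hodgecm-mathlib`, crux h413 = `stmt-HodgeConjecture-24833`, route of record `HCCMUnconditional`; R90-TF section S8 «ContSpec-n½», road R2-χ₃ ((V) OF RECORD row (iii) `hA32`,
ARCH column; ★ p864366∕p864422 consume ★ p864325 whose weight is ★ p13's big-cell law read through four letters).  THEOREMS ONLY (no `def`, no `instance`, no notation, no named-fact
hypothesis, no `sorry`; default heartbeats); lane `--supports stmt-HodgeConjecture-24833 --as helper` (count-neutral).  Closes no socket.

THE MATHEMATICS ([Rogawski1990] §1.10, §2.2; [MoeglinWaldspurger1995] I.2.2, IV.1.11; [BorelJacquet1979] §4.1).  ★ K2E1-p13's laws `archSectionE_midBlock_bigCell` ∕ `archSectionShifted_midBlock_bigCell`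
express the archimedean witness section at `a ∈ G_∞` through FOUR LETTERS about the last row `x(a) = ((ι_∞ a)₂₀, (ι_∞ a)₂₁, (ι_∞ a)₂₂)` and the functional `ℓ(a) = x₂ − x₀` (★ `archLastRow`,
★ `archLastRowL`): `hℓ : ℓ(a) = (y, 1)` an archimedean idele, `hy : ψ_w(y_w) = Z_w − 1`, `h0 : ψ_w((x₀)_w) = 1`, `h2 : ψ_w((x₂)_w) = Z_w`.  THE ELEMENT OF RECORD is the archimedean part
`a := archPart (ι(w₀)·u(X, θ t))` of the adelic big-cell element (`u = heisChart`, `θ = traceZeroLine`, ★ (a2)₃ currency); its adelic last row is `(1, X, z(X, θ t))` (★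
`lastRow_weylLongU_mul_heisChart`), and the archimedean part of the last row of `archPart g` IS the archimedean part of the last row of `g` (§1 `archLastRow_archPart_fst`, from ★
`GLn.coe_ofInfinite_apply` ∘ `coe_archPart`; finite parts `δ₂ⱼ` ★ `archLastRow_snd`).  Reading `z` in `ℂ ≅ L_w` (★ `extensionEmbedding_fst_heisZ`, ★ `extensionEmbedding_fst_coe_traceZeroLine`):
`Z_w := ψ_w(z_w) = s_w(t)·φ_w(δ) − ½‖X_w‖²`, with `Re φ_w(δ) = 0` (★ `embedding_re_eq_zero`), so `Re(Z_w − 1) = −(1 + ½‖X_w‖²) < 0` and `y_w := z_w − 1` is a UNIT of `L_∞`; then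
`ℓ(a) = (z − 1, 1) = (y, 1)` (★ `archLastRowL_snd`, ★ `coe_infiniteIdeles_eq`).  Hence `h0 h2 hℓ hy` hold at `a` — and ★ p13's two laws hold AT THE ELEMENT OF RECORD WITH NO LETTER (§3).
* §1 `archLastRow_archPart_fst` (any `g ∈ G(𝔸)`), `archLastRow_bigCell_fst` (`= (1, X, z)` at the big-cell element), `re_Z_sub_one` (the real part), `heisZ_fst_sub_one_ne_zero`.
* §2 HEAD **`exists_lastRowReadings_bigCell (X) (t) : ∃ y : L_∞ˣ, hℓ ∧ hy ∧ h0 ∧ h2`** at `a`, `Z_w = s_w(t)·φ_w(δ) − ½‖X_w‖²`.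
* §3 **`archSectionE_midBlock_bigCell_of_record`**, **`archSectionShifted_midBlock_bigCell_of_record`** — ★ p13's laws at `a` with the four letters DISCHARGED.
HONEST LABEL: HC_CM is proved only modulo the 7 printed citations (2 remaining named inputs: hLiu418 = `stmt-HodgeConjecture-24832`, h413 = `stmt-HodgeConjecture-24833`) until rung 0
closes; REL ≠ ★ ≠ BUILT; this file asserts no named fact and closes no socket — after it the ARCH column of (V) has no visible letter except ESTATE T's exports; count-neutral.

## References
* [Rogawski1990] J. D. Rogawski, *Automorphic Representations of Unitary Groups in Three Variables*, Ann. of Math. Stud. 123 (1990), §1.10 p. 9, §2.2 p. 13.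
* [MoeglinWaldspurger1995] C. Mœglin, J.-L. Waldspurger, *Spectral Decomposition and Eisenstein Series* (1995), I.2.2, IV.1.11.
* [BorelJacquet1979] A. Borel, H. Jacquet, *Automorphic forms and automorphic representations*, Corvallis PSPM 33.1 (1979), §4.1.
-/

set_option autoImplicit false
set_option linter.dupNamespace false -- the mandated namespace repeats `HodgeConjecture.HodgeConjecture`

noncomputable section

open NumberField NumberField.InfinitePlace ComplexConjugate
open Literature.NumberTheory.Automorphic Literature.NumberTheory.Automorphic.UnitaryGroup Literature.NumberTheory.GaloisRepresentations AdelicGroupData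
open Literature.NumberTheory.Automorphic.Arthur2013.Leaves.TECR
open Literature.NumberTheory.Automorphic.UnitaryGroup.AdelicCharactersDetQuasiSplit (antidiagonal_over_det_ne_zero)
open Literature.NumberTheory.Rogawski1990 (OneDimAutRepH)
open Summit.HodgeConjecture.HodgeConjecture.Cruxes.H413
open Summit.HodgeConjecture.HodgeConjecture.Cruxes.H413.K2E1HeightBigCellLineFormulaU3 (lastRow_weylLongU_mul_heisChart extensionEmbedding_fst_heisZ extensionEmbedding_fst_coe_traceZeroLine embedding_re_eq_zero)
open Summit.HodgeConjecture.HodgeConjecture.Cruxes.H413.K2E1ArchSectionLOnBigCellU3 (archSectionE_midBlock_bigCell)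
open Summit.HodgeConjecture.HodgeConjecture.R90.S8

namespace Summit.HodgeConjecture.HodgeConjecture.Cruxes.H413.K2E1ChiArchBigCellLastRowReadingsU3

variable (L : Type) [Field L] [NumberField L] [IsCMField L]

/-! ## §1 The archimedean part of the last row of `archPart g`; the big-cell element -/

/-- **THE ARCHIMEDEAN PART OF THE LAST ROW OF `ι_∞(g_∞)` IS THE ARCHIMEDEAN PART OF THE LAST ROW OF `g`** (`g ∈ U(J₃)(𝔸_{L⁺})`; ★ `GLn.coe_ofInfinite_apply`, ★ `coe_archPart`:
`(g_∞, 1)` has entries `(e⁻¹(e((g_{ij})_∞)), δ_{ij})`). [cite: BorelJacquet1979, §4.1] -/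
theorem archLastRow_archPart_fst (g : (quasiSplit (↥(maximalRealSubfield L)) L (IsCMField.complexConj L) 3).Adelic) (j : Fin 3) :
    (archLastRow L (archPart (↥(maximalRealSubfield L)) L (IsCMField.complexConj L) 3 ((StdForm.antidiagonal 3).over L) g) j).1 =
      (((adelicVal (↥(maximalRealSubfield L)) L (IsCMField.complexConj L) 3 ((StdForm.antidiagonal 3).over L) g : GL (Fin 3) (AdeleRing (𝓞 L) L)) :
        Matrix (Fin 3) (Fin 3) (AdeleRing (𝓞 L) L)) 2 j).1 := by
  rw [archLastRow_def, adelicVal_archToAdelic, GLn.coe_ofInfinite_apply]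
  show (InfiniteAdeleRing.ringEquiv_mixedSpace L).symm
      (((GLn.toMixed 3 L (adelicVal (↥(maximalRealSubfield L)) L (IsCMField.complexConj L) 3 ((StdForm.antidiagonal 3).over L) g) : GL (Fin 3) (NumberField.mixedEmbedding.mixedSpace L)) :
        Matrix (Fin 3) (Fin 3) (NumberField.mixedEmbedding.mixedSpace L)) 2 j) = _
  rw [show (((GLn.toMixed 3 L (adelicVal (↥(maximalRealSubfield L)) L (IsCMField.complexConj L) 3 ((StdForm.antidiagonal 3).over L) g) : GL (Fin 3) (NumberField.mixedEmbedding.mixedSpace L)) :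
      Matrix (Fin 3) (Fin 3) (NumberField.mixedEmbedding.mixedSpace L)) 2 j) = InfiniteAdeleRing.ringEquiv_mixedSpace L
        ((((adelicVal (↥(maximalRealSubfield L)) L (IsCMField.complexConj L) 3 ((StdForm.antidiagonal 3).over L) g : GL (Fin 3) (AdeleRing (𝓞 L) L)) :
          Matrix (Fin 3) (Fin 3) (AdeleRing (𝓞 L) L)) 2 j).1) from rfl, RingEquiv.symm_apply_apply]

variable {δ : L} (hcδ : IsCMField.complexConj L δ = -δ) (hδ : δ ≠ 0) (hc : IsCMField.complexConj L * IsCMField.complexConj L = 1)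

include hc in
/-- **THE LAST ROW OF THE BIG-CELL ELEMENT, archimedean part**: for `g = ι(w₀)·u(X, y)` (`u = heisChart`), the archimedean part of the last row of `ι_∞(g_∞)` is that of
`(1, X, z(X, y))` (★ `lastRow_weylLongU_mul_heisChart` + `archLastRow_archPart_fst`). [cite: Rogawski1990, §1.10 p. 9] [cite: MoeglinWaldspurger1995, I.2.2] -/
theorem archLastRow_bigCell_fst (X : AdeleRing (𝓞 L) L) (y : traceZeroAdele (↥(maximalRealSubfield L)) L (IsCMField.complexConj L)) (j : Fin 3) :
    (archLastRow L (archPart (↥(maximalRealSubfield L)) L (IsCMField.complexConj L) 3 ((StdForm.antidiagonal 3).over L)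
        ((quasiSplit (↥(maximalRealSubfield L)) L (IsCMField.complexConj L) 3).toAdelic (weylLongU ((IsCMField.complexConj L : L ≃ₐ[↥(maximalRealSubfield L)] L) : L →+* L) (rfl : (StdForm.antidiagonal 3).over L = (StdForm.antidiagonal 3).over L)) *
          ((heisChart hc (X, y) : adelicUnipotent (↥(maximalRealSubfield L)) L (IsCMField.complexConj L) 3) : (quasiSplit (↥(maximalRealSubfield L)) L (IsCMField.complexConj L) 3).Adelic))) j).1 =
      ((![1, X, heisZ (c := IsCMField.complexConj L) X y] : Fin 3 → AdeleRing (𝓞 L) L) j).1 := by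
  rw [archLastRow_archPart_fst]
  have h := congrFun (lastRow_weylLongU_mul_heisChart (F := ↥(maximalRealSubfield L)) hc X y) j
  rw [lastRow_apply] at h
  have e : (⊤ : Fin 3) = 2 := rfl
  rw [e] at h
  rw [h]

include hcδ in
/-- **`Re(Z_w − 1) = −(1 + ½‖X_w‖²)`** for `Z_w = s·φ_w(δ) − ½‖X_w‖²` (`φ_w(δ)` is purely imaginary, ★ `embedding_re_eq_zero`). [cite: Rogawski1990, §1.10 p. 9] -/
theorem re_Z_sub_one (s r : ℝ) (w : InfinitePlace L) :
    (((s : ℂ) * w.embedding δ - ((r ^ 2 / 2 : ℝ) : ℂ)) - 1).re = -(1 + r ^ 2 / 2) := by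
  rw [Complex.sub_re, Complex.sub_re, Complex.re_ofReal_mul, embedding_re_eq_zero L hcδ w, mul_zero, Complex.ofReal_re, Complex.one_re]
  ring

include hcδ in
/-- **`z(X, θ t)_w − 1 ≠ 0` AT EVERY ARCHIMEDEAN PLACE** (its image in `ℂ` has real part `−(1 + ½‖X_w‖²) < 0`). [cite: Rogawski1990, §1.10 p. 9] -/
theorem heisZ_fst_sub_one_ne_zero (X : AdeleRing (𝓞 L) L) (t : AdeleRing (𝓞 ↥(maximalRealSubfield L)) ↥(maximalRealSubfield L)) (w : InfinitePlace L) :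
    (heisZ (c := IsCMField.complexConj L) X ((traceZeroLine (↥(maximalRealSubfield L)) L (IsCMField.complexConj L) hcδ hδ t :
        traceZeroAdele (↥(maximalRealSubfield L)) L (IsCMField.complexConj L)) : AdeleRing (𝓞 L) L)).1 w - 1 ≠ 0 := by
  intro h
  have h' := congrArg (fun u => (Completion.extensionEmbedding w u).re) h
  simp only [map_sub, map_one, map_zero, Complex.zero_re] at h'
  rw [extensionEmbedding_fst_heisZ, extensionEmbedding_fst_coe_traceZeroLine L hcδ hδ t w (K2E1HeightBigCellLineFormulaU2.isReal_comap_maximalRealSubfield L w),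
    re_Z_sub_one L hcδ] at h'
  have : (0 : ℝ) < 1 + ‖X.1 w‖ ^ 2 / 2 := by positivity
  linarith

/-! ## §2 HEAD: the four last-row readings at the archimedean big-cell element of record -/

include hc in
/-- **HEAD.  THE LAST-ROW READINGS OF THE ARCHIMEDEAN BIG-CELL ELEMENT OF RECORD.**  For `X ∈ 𝔸_L`, `t ∈ 𝔸_{L⁺}` and `a := (ι(w₀)·u(X, θ t))_∞ = archPart (ι(w₀)·heisChart (X, θ t))`,
with `Z_w := s_w(t)·φ_w(δ) − ½‖X_w‖²` (`s_w(t)` = the real coordinate of `t_∞` under `w ∣ L⁺`): there is an archimedean unit `y ∈ L_∞ˣ` (namely `y_w = z_w − 1`) with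
(hℓ) `ℓ(a) = (y, 1)`, (hy) `ψ_w(y_w) = Z_w − 1`, (h0) `ψ_w((x₀(a))_w) = 1`, (h2) `ψ_w((x₂(a))_w) = Z_w` — the four letters of ★ `archSectionE_midBlock_bigCell` ∕ ★ `archSectionShifted_midBlock_bigCell`.
[cite: Rogawski1990, §1.10 p. 9, §2.2 p. 13] [cite: MoeglinWaldspurger1995, I.2.2, IV.1.11] [cite: BorelJacquet1979, §4.1] -/
theorem exists_lastRowReadings_bigCell (X : AdeleRing (𝓞 L) L) (t : AdeleRing (𝓞 ↥(maximalRealSubfield L)) ↥(maximalRealSubfield L)) :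
    ∃ y : (InfiniteAdeleRing L)ˣ,
      archLastRowL L (archPart (↥(maximalRealSubfield L)) L (IsCMField.complexConj L) 3 ((StdForm.antidiagonal 3).over L)
          ((quasiSplit (↥(maximalRealSubfield L)) L (IsCMField.complexConj L) 3).toAdelic (weylLongU ((IsCMField.complexConj L : L ≃ₐ[↥(maximalRealSubfield L)] L) : L →+* L) (rfl : (StdForm.antidiagonal 3).over L = (StdForm.antidiagonal 3).over L)) *
            ((heisChart hc (X, traceZeroLine (↥(maximalRealSubfield L)) L (IsCMField.complexConj L) hcδ hδ t) : adelicUnipotent (↥(maximalRealSubfield L)) L (IsCMField.complexConj L) 3) :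
              (quasiSplit (↥(maximalRealSubfield L)) L (IsCMField.complexConj L) 3).Adelic))) =
        ((infiniteIdeles L y : ideleGroup L) : AdeleRing (𝓞 L) L) ∧
      (∀ w : InfinitePlace L, Completion.extensionEmbedding w ((y : InfiniteAdeleRing L) w) =
        ((((InfiniteAdeleRing.ringEquiv_mixedSpace ↥(maximalRealSubfield L) t.1).1 ⟨w.comap (algebraMap ↥(maximalRealSubfield L) L), K2E1HeightBigCellLineFormulaU2.isReal_comap_maximalRealSubfield L w⟩ : ℝ) : ℂ) *
            w.embedding δ - ((‖X.1 w‖ ^ 2 / 2 : ℝ) : ℂ)) - 1) ∧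
      (∀ w : InfinitePlace L, Completion.extensionEmbedding w ((archLastRow L (archPart (↥(maximalRealSubfield L)) L (IsCMField.complexConj L) 3 ((StdForm.antidiagonal 3).over L)
          ((quasiSplit (↥(maximalRealSubfield L)) L (IsCMField.complexConj L) 3).toAdelic (weylLongU ((IsCMField.complexConj L : L ≃ₐ[↥(maximalRealSubfield L)] L) : L →+* L) (rfl : (StdForm.antidiagonal 3).over L = (StdForm.antidiagonal 3).over L)) *
            ((heisChart hc (X, traceZeroLine (↥(maximalRealSubfield L)) L (IsCMField.complexConj L) hcδ hδ t) : adelicUnipotent (↥(maximalRealSubfield L)) L (IsCMField.complexConj L) 3) :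
              (quasiSplit (↥(maximalRealSubfield L)) L (IsCMField.complexConj L) 3).Adelic))) 0).1 w) = 1) ∧
      (∀ w : InfinitePlace L, Completion.extensionEmbedding w ((archLastRow L (archPart (↥(maximalRealSubfield L)) L (IsCMField.complexConj L) 3 ((StdForm.antidiagonal 3).over L)
          ((quasiSplit (↥(maximalRealSubfield L)) L (IsCMField.complexConj L) 3).toAdelic (weylLongU ((IsCMField.complexConj L : L ≃ₐ[↥(maximalRealSubfield L)] L) : L →+* L) (rfl : (StdForm.antidiagonal 3).over L = (StdForm.antidiagonal 3).over L)) *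
            ((heisChart hc (X, traceZeroLine (↥(maximalRealSubfield L)) L (IsCMField.complexConj L) hcδ hδ t) : adelicUnipotent (↥(maximalRealSubfield L)) L (IsCMField.complexConj L) 3) :
              (quasiSplit (↥(maximalRealSubfield L)) L (IsCMField.complexConj L) 3).Adelic))) 2).1 w) =
        (((InfiniteAdeleRing.ringEquiv_mixedSpace ↥(maximalRealSubfield L) t.1).1 ⟨w.comap (algebraMap ↥(maximalRealSubfield L) L), K2E1HeightBigCellLineFormulaU2.isReal_comap_maximalRealSubfield L w⟩ : ℝ) : ℂ) *
            w.embedding δ - ((‖X.1 w‖ ^ 2 / 2 : ℝ) : ℂ)) := by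
  -- abbreviations: the trace-zero coordinate `θ t`, the `z`-entry, the unit `y = z − 1`
  set θt : traceZeroAdele (↥(maximalRealSubfield L)) L (IsCMField.complexConj L) := traceZeroLine (↥(maximalRealSubfield L)) L (IsCMField.complexConj L) hcδ hδ t with hθt
  set z : AdeleRing (𝓞 L) L := heisZ (c := IsCMField.complexConj L) X (θt : AdeleRing (𝓞 L) L) with hz
  -- the closed form of `ψ_w(z_w)`
  have hZ : ∀ w : InfinitePlace L, Completion.extensionEmbedding w (z.1 w) =
      (((InfiniteAdeleRing.ringEquiv_mixedSpace ↥(maximalRealSubfield L) t.1).1 ⟨w.comap (algebraMap ↥(maximalRealSubfield L) L), K2E1HeightBigCellLineFormulaU2.isReal_comap_maximalRealSubfield L w⟩ : ℝ) : ℂ) *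
          w.embedding δ - ((‖X.1 w‖ ^ 2 / 2 : ℝ) : ℂ) := fun w => by
    rw [hz, extensionEmbedding_fst_heisZ, hθt, extensionEmbedding_fst_coe_traceZeroLine L hcδ hδ t w (K2E1HeightBigCellLineFormulaU2.isReal_comap_maximalRealSubfield L w)]
  -- the unit `y_w := z_w − 1`
  have hne : ∀ w : InfinitePlace L, z.1 w - 1 ≠ 0 := fun w => heisZ_fst_sub_one_ne_zero L hcδ hδ X t w
  have hunit : IsUnit (z.1 - 1 : InfiniteAdeleRing L) := by
    refine isUnit_iff_exists_inv.2 ⟨fun w => (z.1 w - 1)⁻¹, funext fun w => ?_⟩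
    show (z.1 w - 1) * (z.1 w - 1)⁻¹ = 1
    exact mul_inv_cancel₀ (hne w)
  -- the last row entries `x₀ = 1`, `x₂ = z` (archimedean parts)
  have h0 : ∀ w : InfinitePlace L, (archLastRow L (archPart (↥(maximalRealSubfield L)) L (IsCMField.complexConj L) 3 ((StdForm.antidiagonal 3).over L)
      ((quasiSplit (↥(maximalRealSubfield L)) L (IsCMField.complexConj L) 3).toAdelic (weylLongU ((IsCMField.complexConj L : L ≃ₐ[↥(maximalRealSubfield L)] L) : L →+* L) (rfl : (StdForm.antidiagonal 3).over L = (StdForm.antidiagonal 3).over L)) *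
        ((heisChart hc (X, θt) : adelicUnipotent (↥(maximalRealSubfield L)) L (IsCMField.complexConj L) 3) : (quasiSplit (↥(maximalRealSubfield L)) L (IsCMField.complexConj L) 3).Adelic))) 0).1 w = 1 := fun w => by
    rw [archLastRow_bigCell_fst L hc X θt 0]
    rfl
  have h2 : ∀ w : InfinitePlace L, (archLastRow L (archPart (↥(maximalRealSubfield L)) L (IsCMField.complexConj L) 3 ((StdForm.antidiagonal 3).over L)
      ((quasiSplit (↥(maximalRealSubfield L)) L (IsCMField.complexConj L) 3).toAdelic (weylLongU ((IsCMField.complexConj L : L ≃ₐ[↥(maximalRealSubfield L)] L) : L →+* L) (rfl : (StdForm.antidiagonal 3).over L = (StdForm.antidiagonal 3).over L)) *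
        ((heisChart hc (X, θt) : adelicUnipotent (↥(maximalRealSubfield L)) L (IsCMField.complexConj L) 3) : (quasiSplit (↥(maximalRealSubfield L)) L (IsCMField.complexConj L) 3).Adelic))) 2).1 w = z.1 w := fun w => by
    rw [archLastRow_bigCell_fst L hc X θt 2]
    rfl
  refine ⟨hunit.unit, Prod.ext ?_ ?_, fun w => ?_, fun w => by rw [h0 w, map_one], fun w => by rw [h2 w, hZ w]⟩
  · -- archimedean part of `ℓ(a) = x₂ − x₀ = z − 1 = y`
    rw [coe_infiniteIdeles_eq, IsUnit.unit_spec, archLastRowL_def]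
    refine funext fun w => ?_
    change (archLastRow L _ 2).1 w - (archLastRow L _ 0).1 w = z.1 w - 1
    rw [h2 w, h0 w]
  · -- finite part `1`
    rw [coe_infiniteIdeles_eq, archLastRowL_snd]
  · -- `ψ_w(y_w) = Z_w − 1`
    rw [IsUnit.unit_spec]
    change Completion.extensionEmbedding w (z.1 w - 1) = _
    rw [map_sub, map_one, hZ w]

/-! ## §3 ★ p13's big-cell laws AT THE ELEMENT OF RECORD, letters discharged -/

include hc in
/-- **★ `archSectionE` OF THE BLOCK OF RECORD AT THE BIG-CELL ELEMENT, NO LETTER**: for `μω` of type `(kμ, 0)`,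
`archSectionE (ξ.bcη⁻¹·ξ.bcψ⁻¹·μω) ξ.ψ a = (∏_w (−1)^{m_w}·conj (archUnitaryValue m_w 0 (1 − conj Z_w))) · ξ.ψ⟨det ι_∞ a⟩` at `a = (ι(w₀)·u(X, θ t))_∞`, `m_w = kμ,w − 2eη,w`,
`Z_w = s_w(t)·φ_w(δ) − ½‖X_w‖²` (★ `archSectionE_midBlock_bigCell` with §2's readings). [cite: MoeglinWaldspurger1995, IV.1.11] [cite: Rogawski1990, §13.9 p. 229] -/
theorem archSectionE_midBlock_bigCell_of_record (ξ : OneDimAutRepH L) {μω : HeckeCharacter L} {kμ : InfinitePlace L → ℤ} (hμ : μω.HasUnitaryArchType kμ 0)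
    (X : AdeleRing (𝓞 L) L) (t : AdeleRing (𝓞 ↥(maximalRealSubfield L)) ↥(maximalRealSubfield L)) :
    archSectionE L (ξ.bcη⁻¹ * ξ.bcψ⁻¹ * μω) ξ.ψ (archPart (↥(maximalRealSubfield L)) L (IsCMField.complexConj L) 3 ((StdForm.antidiagonal 3).over L)
        ((quasiSplit (↥(maximalRealSubfield L)) L (IsCMField.complexConj L) 3).toAdelic (weylLongU ((IsCMField.complexConj L : L ≃ₐ[↥(maximalRealSubfield L)] L) : L →+* L) (rfl : (StdForm.antidiagonal 3).over L = (StdForm.antidiagonal 3).over L)) *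
          ((heisChart hc (X, traceZeroLine (↥(maximalRealSubfield L)) L (IsCMField.complexConj L) hcδ hδ t) : adelicUnipotent (↥(maximalRealSubfield L)) L (IsCMField.complexConj L) 3) :
            (quasiSplit (↥(maximalRealSubfield L)) L (IsCMField.complexConj L) 3).Adelic))) =
      (∏ w : InfinitePlace L, (-1) ^ (kμ w - 2 * ξ.eη w) * conj (archUnitaryValue (kμ w - 2 * ξ.eη w) 0 (1 - conj ((((InfiniteAdeleRing.ringEquiv_mixedSpace ↥(maximalRealSubfield L) t.1).1 ⟨w.comap (algebraMap ↥(maximalRealSubfield L) L), K2E1HeightBigCellLineFormulaU2.isReal_comap_maximalRealSubfield L w⟩ : ℝ) : ℂ) * w.embedding δ - ((‖X.1 w‖ ^ 2 / 2 : ℝ) : ℂ))))) *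
      ((adelicOneChar (↥(maximalRealSubfield L)) L (IsCMField.complexConj L) ξ.ψ
        (adelicDet (↥(maximalRealSubfield L)) L (IsCMField.complexConj L) 3 ((StdForm.antidiagonal 3).over L) (antidiagonal_over_det_ne_zero L 3)
          (archToAdelic (↥(maximalRealSubfield L)) L (IsCMField.complexConj L) 3 ((StdForm.antidiagonal 3).over L) (archPart (↥(maximalRealSubfield L)) L (IsCMField.complexConj L) 3 ((StdForm.antidiagonal 3).over L)
        ((quasiSplit (↥(maximalRealSubfield L)) L (IsCMField.complexConj L) 3).toAdelic (weylLongU ((IsCMField.complexConj L : L ≃ₐ[↥(maximalRealSubfield L)] L) : L →+* L) (rfl : (StdForm.antidiagonal 3).over L = (StdForm.antidiagonal 3).over L)) *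
          ((heisChart hc (X, traceZeroLine (↥(maximalRealSubfield L)) L (IsCMField.complexConj L) hcδ hδ t) : adelicUnipotent (↥(maximalRealSubfield L)) L (IsCMField.complexConj L) 3) :
            (quasiSplit (↥(maximalRealSubfield L)) L (IsCMField.complexConj L) 3).Adelic))))) : ℂˣ) : ℂ) := by
  obtain ⟨y, hℓ, hy, -, -⟩ := exists_lastRowReadings_bigCell L hcδ hδ hc X t
  exact archSectionE_midBlock_bigCell L ξ hμ _ y _ hℓ hy

include hc in
/-- **★ `archSectionShifted` OF THE BLOCK OF RECORD AT THE BIG-CELL ELEMENT, NO LETTER**: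
`Φ^{p,q}(a) = (∏_w ((Z_w+1)∕(Z_w−1))^{p_w}((conj Z_w+1)∕(conj Z_w−1))^{q_w}) · (∏_w (−1)^{m_w} conj (archUnitaryValue m_w 0 (1 − conj Z_w))) · ξ.ψ⟨det ι_∞ a⟩` at `a = (ι(w₀)·u(X, θ t))_∞`,
`Z_w = s_w(t)·φ_w(δ) − ½‖X_w‖²` (★ `archSectionShifted_midBlock_bigCell` with §2's readings) — the arch weight that ★ p864325 ∕ ★ p864366 integrate, now tied to the element of record.
[cite: MoeglinWaldspurger1995, IV.1.11] [cite: Rogawski1990, §1.10 p. 9] -/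
theorem archSectionShifted_midBlock_bigCell_of_record (ξ : OneDimAutRepH L) {μω : HeckeCharacter L} {kμ : InfinitePlace L → ℤ} (hμ : μω.HasUnitaryArchType kμ 0)
    (p q : InfinitePlace L → ℕ) (X : AdeleRing (𝓞 L) L) (t : AdeleRing (𝓞 ↥(maximalRealSubfield L)) ↥(maximalRealSubfield L)) :
    archSectionShifted L (ξ.bcη⁻¹ * ξ.bcψ⁻¹ * μω) ξ.ψ p q (archPart (↥(maximalRealSubfield L)) L (IsCMField.complexConj L) 3 ((StdForm.antidiagonal 3).over L)
        ((quasiSplit (↥(maximalRealSubfield L)) L (IsCMField.complexConj L) 3).toAdelic (weylLongU ((IsCMField.complexConj L : L ≃ₐ[↥(maximalRealSubfield L)] L) : L →+* L) (rfl : (StdForm.antidiagonal 3).over L = (StdForm.antidiagonal 3).over L)) *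
          ((heisChart hc (X, traceZeroLine (↥(maximalRealSubfield L)) L (IsCMField.complexConj L) hcδ hδ t) : adelicUnipotent (↥(maximalRealSubfield L)) L (IsCMField.complexConj L) 3) :
            (quasiSplit (↥(maximalRealSubfield L)) L (IsCMField.complexConj L) 3).Adelic))) =
      (∏ w : InfinitePlace L, ((((((InfiniteAdeleRing.ringEquiv_mixedSpace ↥(maximalRealSubfield L) t.1).1 ⟨w.comap (algebraMap ↥(maximalRealSubfield L) L), K2E1HeightBigCellLineFormulaU2.isReal_comap_maximalRealSubfield L w⟩ : ℝ) : ℂ) * w.embedding δ - ((‖X.1 w‖ ^ 2 / 2 : ℝ) : ℂ)) + 1) / (((((InfiniteAdeleRing.ringEquiv_mixedSpace ↥(maximalRealSubfield L) t.1).1 ⟨w.comap (algebraMap ↥(maximalRealSubfield L) L), K2E1HeightBigCellLineFormulaU2.isReal_comap_maximalRealSubfield L w⟩ : ℝ) : ℂ) * w.embedding δ - ((‖X.1 w‖ ^ 2 / 2 : ℝ) : ℂ)) - 1)) ^ p w * ((conj ((((InfiniteAdeleRing.ringEquiv_mixedSpace ↥(maximalRealSubfield L) t.1).1 ⟨w.comap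 (algebraMap ↥(maximalRealSubfield L) L), K2E1HeightBigCellLineFormulaU2.isReal_comap_maximalRealSubfield L w⟩ : ℝ) : ℂ) * w.embedding δ - ((‖X.1 w‖ ^ 2 / 2 : ℝ) : ℂ)) + 1) / (conj ((((InfiniteAdeleRing.ringEquiv_mixedSpace ↥(maximalRealSubfield L) t.1).1 ⟨w.comap (algebraMap ↥(maximalRealSubfield L) L), K2E1HeightBigCellLineFormulaU2.isReal_comap_maximalRealSubfield L w⟩ : ℝ) : ℂ) * w.embedding δ - ((‖X.1 w‖ ^ 2 / 2 : ℝ) : ℂ)) - 1)) ^ q w) *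
        ((∏ w : InfinitePlace L, (-1) ^ (kμ w - 2 * ξ.eη w) * conj (archUnitaryValue (kμ w - 2 * ξ.eη w) 0 (1 - conj ((((InfiniteAdeleRing.ringEquiv_mixedSpace ↥(maximalRealSubfield L) t.1).1 ⟨w.comap (algebraMap ↥(maximalRealSubfield L) L), K2E1HeightBigCellLineFormulaU2.isReal_comap_maximalRealSubfield L w⟩ : ℝ) : ℂ) * w.embedding δ - ((‖X.1 w‖ ^ 2 / 2 : ℝ) : ℂ))))) *
          ((adelicOneChar (↥(maximalRealSubfield L)) L (IsCMField.complexConj L) ξ.ψ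
            (adelicDet (↥(maximalRealSubfield L)) L (IsCMField.complexConj L) 3 ((StdForm.antidiagonal 3).over L) (antidiagonal_over_det_ne_zero L 3)
              (archToAdelic (↥(maximalRealSubfield L)) L (IsCMField.complexConj L) 3 ((StdForm.antidiagonal 3).over L) (archPart (↥(maximalRealSubfield L)) L (IsCMField.complexConj L) 3 ((StdForm.antidiagonal 3).over L)
        ((quasiSplit (↥(maximalRealSubfield L)) L (IsCMField.complexConj L) 3).toAdelic (weylLongU ((IsCMField.complexConj L : L ≃ₐ[↥(maximalRealSubfield L)] L) : L →+* L) (rfl : (StdForm.antidiagonal 3).over L = (StdForm.antidiagonal 3).over L)) *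
          ((heisChart hc (X, traceZeroLine (↥(maximalRealSubfield L)) L (IsCMField.complexConj L) hcδ hδ t) : adelicUnipotent (↥(maximalRealSubfield L)) L (IsCMField.complexConj L) 3) :
            (quasiSplit (↥(maximalRealSubfield L)) L (IsCMField.complexConj L) 3).Adelic))))) : ℂˣ) : ℂ)) := by
  obtain ⟨y, hℓ, hy, h0, h2⟩ := exists_lastRowReadings_bigCell L hcδ hδ hc X t
  exact archSectionShifted_midBlock_bigCell L ξ hμ p q _ y _ hℓ hy h0 h2

end Summit.HodgeConjecture.HodgeConjecture.Cruxes.H413.K2E1ChiArchBigCellLastRowReadingsU3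

end
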